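import Summits.CriticalPhenomena.PercolationContinuityZ3.Theorems.PercNearOneGluingAdditiveGluingCSHSetDefs
import Literature.Probability.Percolation.TwoClusterGibbsJointCovarianceMeasure
import Summits.CriticalPhenomena.PercolationContinuityZ3.Theorems.PercNearOneGluingNoHeavyLowerTailCSHLemmaT
import Literature.Probability.Percolation.KozmaNitzanClusterPropertyReal
import HarnessLib

/-!
# Conjecture G / SET-W via a SET observer, IX: LEMMA T-set (the Gibbs-sampler reduction of a CSH-set margin to its world-wise form)

Support file (`--supports stmt-CriticalPhenomena-4576`); no definitions, no named facts, no sorries.  Seat (b) V⁺-form `png-dp-vplus`, gen 12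
(memo MEMO-gen12.md §4(a), §10 (T) of run/shared/lean/prim/prim-png-dp-vplus/).  Set-observer version of prim-gen-induct's `CSH.cshMargin_nonneg_of_within`
(`…NoHeavyLowerTailCSHLemmaT.lean`):

* uses the Literature reduction theorem for a TWO-ARGUMENT ("joint") test function `h(C_s, C_X)` antitone in `C_X`
  (`BHK2006_clusterJointTestCov_nonneg_of_within`, Literature/…/TwoClusterGibbsJointCovarianceMeasure.lean; the seat's sum-level version is
  `SetGibbs.covD₂_nonneg_of_withinD₂_nonneg` of `…SetObserverGibbs.lean`);
* `CSHSet.cshMarginSet_nonneg_of_within` — **LEMMA T-set**: if the WORLD-WISE CSH-set margin (worlds = weights zeroed on the pairs meeting `C_Y(ω)`,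
  set slot = `{O ~ x} ∩ {O misses Y ∪ V(C_Y ω)}`: the observer set is killed when it meets the world boundary) is `≥ 0` for every monotone `g ≥ 0`,
  then `CSHSet.cshMarginSet w x Y D O v f ≥ 0` for every monotone `f`.  The set slot's test function `1{O~x}·1{O≁Y}` is antitone in `C_Y` and enters
  the margin with coefficient `+1` (`cshMarg_single_none`), so the whole multi-slot test function is antitone in `C_Y`.
[cite: VandenbergHaggstromKahn2005, §2.1 pp. 10–13, Lemma 2.4 (p. 10)] [cite: KozmaNitzan2024, Conj. 4 (p. 32)]
-/

noncomputable section

namespace Summit.CriticalPhenomena.PercolationContinuityZ3.Theorems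

open MeasureTheory Set Literature.Probability.LatticeModels Literature.Probability.Percolation
open Literature.Probability.Percolation.BHK2006 Literature.Probability.Percolation.DecisionTree
open scoped Classical

/-! ## LEMMA T-set -/

namespace CSHSet

open CSH Literature.Probability.Percolation.BHK2006 Literature.Probability.Percolation.DecisionTree

variable {V : Type*} [Fintype V]

omit [Fintype V] in
/-- The coefficient of the set-observer slot in a margin is one: `Marg[δ_none] = 1` (no decoy is the slot `none`, nor is `some v`). [folklore] -/
theorem cshMarg_single_none (w : Sym2 V → unitInterval) (O : Finset V) (A : Set V) (D : List V) (p : ℝ) (v : V) :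
    cshMarg (decoyListSet w O A D) p none (some v) (Pi.single none (1 : ℝ)) = 1 := by
  have key : ∀ (L : List (Option V × (Option V → ℝ))), (∀ dc ∈ L, ∃ d : V, dc.1 = some d) →
      cshMarg L p none (some v) (Pi.single none (1 : ℝ)) = 1 := by
    intro L hL
    induction L with
    | nil => simp [cshMarg_nil]
    | cons dc L ih =>
      obtain ⟨d₀, c₀⟩ := dc
      obtain ⟨d, hd⟩ := hL (d₀, c₀) List.mem_cons_self
      simp only at hd
      rw [cshMarg_cons, ih (fun dc hdc => hL dc (List.mem_cons_of_mem _ hdc)), hd,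
        Pi.single_eq_of_ne (Option.some_ne_none d), zero_mul, sub_zero]
  exact key _ fun dc hdc => by
    obtain ⟨d, _, hd⟩ := mem_decoyListSet w O A D dc hdc
    exact ⟨d, hd⟩

/-- The slot indicators read off the owner's edge cluster and the avoided set's edge cluster: vertex slot `u` ↦ `1{u = x ∨ u ∈ V(C_x)}`,
set slot ↦ `1{O meets {x} ∪ V(C_x)} · 1{O misses Y ∪ V(C_Y)}`. [folklore] -/
theorem slotInd_eq (O : Finset V) (x : V) (Y : Set V) (ω : BondConfig V) (s : Option V) :
    (match s with
      | none => (if (∃ o ∈ O, o = x ∨ ∃ e ∈ openEdgeCluster ω x, o ∈ e) then (1 : ℝ) else 0) *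
          (if (∀ o ∈ O, ¬ (o ∈ Y ∨ ∃ e ∈ setCl ω Y, o ∈ e)) then (1 : ℝ) else 0)
      | some u => (if (u = x ∨ ∃ e ∈ openEdgeCluster ω x, u ∈ e) then (1 : ℝ) else 0)) =
      (slotEv O x Y s).indicator (1 : BondConfig V → ℝ) ω := by
  cases s with
  | some u => simp only [slotEv_some]; exact ite_mem_openEdgeCluster_eq_indicator ω x u
  | none =>
    simp only [slotEv_none]
    have htouch : (∃ o ∈ O, o = x ∨ ∃ e ∈ openEdgeCluster ω x, o ∈ e) ↔ ∃ o ∈ O, (openGraph ω).Reachable o x := by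
      constructor
      · rintro ⟨o, ho, h⟩; exact ⟨o, ho, ((reachable_iff_exists_mem_openEdgeCluster ω x o).2 h).symm⟩
      · rintro ⟨o, ho, h⟩; exact ⟨o, ho, (reachable_iff_exists_mem_openEdgeCluster ω x o).1 h.symm⟩
    have havoid : (∀ o ∈ O, ¬ (o ∈ Y ∨ ∃ e ∈ setCl ω Y, o ∈ e)) ↔ ∀ o ∈ O, ∀ y ∈ Y, ¬ (openGraph ω).Reachable o y := by
      refine forall₂_congr fun o _ => ?_
      rw [← setReach_iff ω Y o]
      simp only [not_exists, not_and]
      exact ⟨fun h y hy hoy => h y hy hoy.symm, fun h y hy hyo => h y hy hyo.symm⟩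
    by_cases hω : ω ∈ obsEv O x Y
    · obtain ⟨h1, h2⟩ := hω
      rw [if_pos (htouch.2 h1), if_pos (havoid.2 h2), Set.indicator_of_mem (show ω ∈ obsEv O x Y from ⟨h1, h2⟩), one_mul,
        Pi.one_apply]
    · rw [Set.indicator_of_notMem hω]
      by_cases h1 : ∃ o ∈ O, (openGraph ω).Reachable o x
      · rw [if_neg (fun h2 => hω ⟨h1, havoid.1 h2⟩), mul_zero]
      · rw [if_neg (fun h => h1 (htouch.1 h)), zero_mul]

/-- The coefficients of a margin with `Option`-slots: `Marg[f] = Σ_s Marg[δ_s]·f(s)` (as `CSH.cshMarg_eq_sum`, restated here so that the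
`Pi.single`s below are elaborated uniformly). [folklore] -/
theorem cshMarg_eq_sum_slots (L : List (Option V × (Option V → ℝ))) (p : ℝ) (o v' : Option V) (f : Option V → ℝ) :
    cshMarg L p o v' f = ∑ u, cshMarg L p o v' (Pi.single u 1) * f u := by
  have hf : f = ∑ u, f u • (Pi.single u (1 : ℝ) : Option V → ℝ) := by
    funext z
    rw [Finset.sum_apply, Finset.sum_eq_single z]
    · simp only [Pi.smul_apply, Pi.single_eq_same, smul_eq_mul, mul_one]
    · intro u _ huz
      simp only [Pi.smul_apply, Pi.single_eq_of_ne (Ne.symm huz), smul_eq_mul, mul_zero]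
    · intro hz; exact absurd (Finset.mem_univ z) hz
  conv_lhs => rw [hf]
  rw [cshMarg_finset_sum]
  exact Finset.sum_congr rfl fun u _ => by rw [cshMarg_smul, mul_comm]

/-- **LEMMA T-set: the Gibbs-sampler reduction of a CSH-set margin to its world-wise form** (set-observer version of
`CSH.cshMargin_nonneg_of_within`).  Owner `x`, avoided set `Y` with `w e < 1` on the non-loop pairs meeting `Y`, decoys `D`, set observer `O`,
vertex observer `v`; `L`, `p` the decoy list and observers' constant of `CSHSet.cshMarginSet`; `w^ω` = `w` zeroed on the pairs meeting the open
vertex cluster of `Y`; world slot events: `some u ↦ {x ↔ u}`, `none ↦ {O ~ x} ∩ {O misses Y ∪ V(C_Y(ω))}` (the observer set is killed when it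
meets the world boundary).  IF for every monotone `g ≥ 0` the world-wise margin
`∫_{x↮Y} Marg_{L,p}[s ↦ ∫_{slot s} g(C_x) dμ_{w^ω} − (∫ g(C_x) dμ_{w^ω})·μ_{w^ω}(slot s)] dμ_w(ω)` is `≥ 0`, THEN
`0 ≤ CSHSet.cshMarginSet w x Y D O v f` for every monotone `f`.  (The set slot's test function is antitone in `C_Y` and has coefficient `+1`.)
[cite: VandenbergHaggstromKahn2005, §2.1 pp. 10–13, Lemma 2.4 (p. 10)] -/
theorem cshMarginSet_nonneg_of_within (w : Sym2 V → unitInterval) (x : V) (Y : Set V) (D : List V) (O : Finset V) (v : V)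
    (hY : ∀ e : Sym2 V, ¬ e.IsDiag → (∃ u ∈ e, u ∈ Y) → (w e : ℝ) < 1)
    (hW : ∀ g : Set (Sym2 V) → ℝ, Monotone g → (∀ C, 0 ≤ g C) →
      (0 : ℝ) ≤ ∫ ω in {ω : BondConfig V | ∀ y ∈ Y, ¬ (openGraph ω).Reachable x y},
        cshMarg (decoyListSet w O (insert x Y) D) (obsConstSet w O v (insert x Y ∪ {d | d ∈ D})) none (some v)
          (fun s => (∫ η in {η : BondConfig V | match s with
                | none => (∃ o ∈ O, (openGraph η).Reachable o x) ∧ ∀ o ∈ O, ¬ (o ∈ Y ∨ ∃ e ∈ setCl ω Y, o ∈ e)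
                | some u => (openGraph η).Reachable x u}, g (openEdgeCluster η x)
                ∂(prodBernoulli fun e => if (∃ z ∈ e, ∃ y ∈ Y, (openGraph ω).Reachable y z)
                  then (0 : unitInterval) else w e)) -
              (∫ η, g (openEdgeCluster η x)
                ∂(prodBernoulli fun e => if (∃ z ∈ e, ∃ y ∈ Y, (openGraph ω).Reachable y z)
                  then (0 : unitInterval) else w e)) *
              (prodBernoulli fun e => if (∃ z ∈ e, ∃ y ∈ Y, (openGraph ω).Reachable y z)
                  then (0 : unitInterval) else w e).real {η : BondConfig V | match s with
                | none => (∃ o ∈ O, (openGraph η).Reachable o x) ∧ ∀ o ∈ O, ¬ (o ∈ Y ∨ ∃ e ∈ setCl ω Y, o ∈ e)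
                | some u => (openGraph η).Reachable x u})
        ∂(prodBernoulli w))
    (f : Set (Sym2 V) → ℝ) (hf : Monotone f) :
    0 ≤ cshMarginSet w x Y D O v f := by
  classical
  set L := decoyListSet w O (insert x Y) D with hL
  set p := obsConstSet w O v (insert x Y ∪ {d | d ∈ D}) with hp
  set Λ : Option V → ℝ := fun s => cshMarg L p none (some v) (Pi.single s 1) with hΛ
  have hΛdef : ∀ s, cshMarg L p none (some v) (Pi.single s 1) = Λ s := fun s => rfl
  have hΛnone : Λ none = 1 := cshMarg_single_none w O (insert x Y) D p v
  set Dset : Set (BondConfig V) := {ω : BondConfig V | ∀ y ∈ Y, ¬ (openGraph ω).Reachable x y} with hDset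
  -- the two-argument test function
  set χ : Option V → Set (Sym2 V) → Set (Sym2 V) → ℝ := fun s A B => match s with
    | none => (if (∃ o ∈ O, o = x ∨ ∃ e ∈ A, o ∈ e) then (1 : ℝ) else 0) * (if (∀ o ∈ O, ¬ (o ∈ Y ∨ ∃ e ∈ B, o ∈ e)) then (1 : ℝ) else 0)
    | some u => (if (u = x ∨ ∃ e ∈ A, u ∈ e) then (1 : ℝ) else 0) with hχ
  set H : Set (Sym2 V) → Set (Sym2 V) → ℝ := fun A B => ∑ s : Option V, Λ s * χ s A B with hH
  have hHanti : ∀ A, Antitone (H A) := by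
    intro A B B' hBB'
    simp only [hH]
    refine Finset.sum_le_sum fun s _ => ?_
    cases s with
    | some u => exact le_rfl
    | none =>
      rw [hΛnone, one_mul, one_mul]
      simp only [hχ]
      refine mul_le_mul_of_nonneg_left ?_ (by split_ifs <;> norm_num)
      by_cases h' : ∀ o ∈ O, ¬ (o ∈ Y ∨ ∃ e ∈ B', o ∈ e)
      · rw [if_pos h', if_pos (fun o ho hc => h' o ho (hc.imp id fun ⟨e, he, hoe⟩ => ⟨e, hBB' he, hoe⟩))]
      · rw [if_neg h']; split_ifs <;> norm_num
  -- (1) the conclusion side: `cshMarginSet = μ(D)∫_D f·H − (∫_D f)(∫_D H)`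
  have hmeas : ∀ S' : Set (BondConfig V), MeasurableSet S' := fun _ => MeasurableSet.of_discrete
  have hHval : ∀ ω : BondConfig V, H (openEdgeCluster ω x) (setCl ω Y) =
      ∑ s : Option V, Λ s * (slotEv O x Y s).indicator (1 : BondConfig V → ℝ) ω := by
    intro ω
    simp only [hH]
    refine Finset.sum_congr rfl fun s _ => ?_
    rw [← slotInd_eq O x Y ω s]
  have split : ∀ G : BondConfig V → ℝ, ∫ ω in Dset, G ω * H (openEdgeCluster ω x) (setCl ω Y) ∂(prodBernoulli w) =
      ∑ s : Option V, Λ s * ∫ ω in Dset ∩ slotEv O x Y s, G ω ∂(prodBernoulli w) := by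
    intro G
    have e1 : (fun ω => G ω * H (openEdgeCluster ω x) (setCl ω Y)) = fun ω =>
        ∑ s : Option V, Λ s * (G ω * (slotEv O x Y s).indicator (1 : BondConfig V → ℝ) ω) := by
      funext ω
      rw [hHval, Finset.mul_sum]
      exact Finset.sum_congr rfl fun s _ => by ring
    rw [e1, integral_finsetSum _ fun s _ => Integrable.of_finite]
    exact Finset.sum_congr rfl fun s _ => by rw [integral_const_mul, KNPreFKG.setIntegral_mul_indicator_one]
  have massD : ∫ ω in Dset, H (openEdgeCluster ω x) (setCl ω Y) ∂(prodBernoulli w) =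
      ∑ s : Option V, Λ s * (prodBernoulli w).real (Dset ∩ slotEv O x Y s) := by
    have h2 := split (fun _ => (1 : ℝ))
    simp only [one_mul] at h2
    rw [h2]
    exact Finset.sum_congr rfl fun s _ => by rw [setIntegral_const, smul_eq_mul, mul_one]
  have hconc : cshMarginSet w x Y D O v f =
      (prodBernoulli w).real Dset * (∫ ω in Dset, f (openEdgeCluster ω x) * H (openEdgeCluster ω x) (setCl ω Y) ∂(prodBernoulli w)) -
        (∫ ω in Dset, f (openEdgeCluster ω x) ∂(prodBernoulli w)) *
          (∫ ω in Dset, H (openEdgeCluster ω x) (setCl ω Y) ∂(prodBernoulli w)) := by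
    rw [cshMarginSet, ← hL, ← hp, cshMarg_eq_sum_slots, split, massD, Finset.mul_sum, Finset.mul_sum, ← Finset.sum_sub_distrib]
    refine Finset.sum_congr rfl fun s _ => ?_
    rw [hΛdef s]
    unfold covDSet
    rw [← hDset]
    ring
  rw [hconc]
  refine BHK2006_clusterJointTestCov_nonneg_of_within w x Y hY H hHanti (fun g hg hg0 => ?_) f hf
  -- (2) the hypothesis side: the fresh-configuration covariance with `H` is the world-wise margin
  have hfresh : ∀ ω : BondConfig V,
      ((∫ η, g (openEdgeCluster (η \ {e | ∃ z ∈ e, ∃ y ∈ Y, (openGraph ω).Reachable y z}) x) *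
            H (openEdgeCluster (η \ {e | ∃ z ∈ e, ∃ y ∈ Y, (openGraph ω).Reachable y z}) x) (setCl ω Y) ∂(prodBernoulli w)) -
        (∫ η, g (openEdgeCluster (η \ {e | ∃ z ∈ e, ∃ y ∈ Y, (openGraph ω).Reachable y z}) x) ∂(prodBernoulli w)) *
        (∫ η, H (openEdgeCluster (η \ {e | ∃ z ∈ e, ∃ y ∈ Y, (openGraph ω).Reachable y z}) x) (setCl ω Y) ∂(prodBernoulli w))) =
      cshMarg L p none (some v)
          (fun s => (∫ η in {η : BondConfig V | match s with
                | none => (∃ o ∈ O, (openGraph η).Reachable o x) ∧ ∀ o ∈ O, ¬ (o ∈ Y ∨ ∃ e ∈ setCl ω Y, o ∈ e)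
                | some u => (openGraph η).Reachable x u}, g (openEdgeCluster η x)
                ∂(prodBernoulli fun e => if (∃ z ∈ e, ∃ y ∈ Y, (openGraph ω).Reachable y z)
                  then (0 : unitInterval) else w e)) -
              (∫ η, g (openEdgeCluster η x)
                ∂(prodBernoulli fun e => if (∃ z ∈ e, ∃ y ∈ Y, (openGraph ω).Reachable y z)
                  then (0 : unitInterval) else w e)) *
              (prodBernoulli fun e => if (∃ z ∈ e, ∃ y ∈ Y, (openGraph ω).Reachable y z)
                  then (0 : unitInterval) else w e).real {η : BondConfig V | match s with
                | none => (∃ o ∈ O, (openGraph η).Reachable o x) ∧ ∀ o ∈ O, ¬ (o ∈ Y ∨ ∃ e ∈ setCl ω Y, o ∈ e)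
                | some u => (openGraph η).Reachable x u}) := by
    intro ω
    set Aω : Set (Sym2 V) := {e | ∃ z ∈ e, ∃ y ∈ Y, (openGraph ω).Reachable y z} with hAω
    set wX : Sym2 V → unitInterval := fun e => if (∃ z ∈ e, ∃ y ∈ Y, (openGraph ω).Reachable y z)
      then (0 : unitInterval) else w e with hwX
    have h0 : ∀ e ∈ Aω, wX e = 0 := fun e he => by simp only [hwX]; exact if_pos he
    have h1 : ∀ e ∉ Aω, wX e = w e := fun e he => by simp only [hwX]; exact if_neg he
    -- the slot events in the world of `ω`
    set Ev : Option V → Set (BondConfig V) := fun s => {η : BondConfig V | match s with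
      | none => (∃ o ∈ O, (openGraph η).Reachable o x) ∧ ∀ o ∈ O, ¬ (o ∈ Y ∨ ∃ e ∈ setCl ω Y, o ∈ e)
      | some u => (openGraph η).Reachable x u} with hEv
    have hχη : ∀ (η : BondConfig V) (s : Option V), χ s (openEdgeCluster η x) (setCl ω Y) = (Ev s).indicator (1 : BondConfig V → ℝ) η := by
      intro η s
      cases s with
      | some u =>
        simp only [hχ, hEv]
        exact ite_mem_openEdgeCluster_eq_indicator η x u
      | none =>
        simp only [hχ, hEv]
        have htouch : (∃ o ∈ O, o = x ∨ ∃ e ∈ openEdgeCluster η x, o ∈ e) ↔ ∃ o ∈ O, (openGraph η).Reachable o x := by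
          constructor
          · rintro ⟨o, ho, h⟩; exact ⟨o, ho, ((reachable_iff_exists_mem_openEdgeCluster η x o).2 h).symm⟩
          · rintro ⟨o, ho, h⟩; exact ⟨o, ho, (reachable_iff_exists_mem_openEdgeCluster η x o).1 h.symm⟩
        by_cases ha : ∃ o ∈ O, (openGraph η).Reachable o x
        · by_cases hb : ∀ o ∈ O, ¬ (o ∈ Y ∨ ∃ e ∈ setCl ω Y, o ∈ e)
          · rw [if_pos (htouch.2 ha), if_pos hb, one_mul, Set.indicator_of_mem, Pi.one_apply]
            exact ⟨ha, hb⟩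
          · rw [if_neg hb, mul_zero, Set.indicator_of_notMem]
            exact fun h => hb h.2
        · rw [if_neg (fun h => ha (htouch.1 h)), zero_mul, Set.indicator_of_notMem]
          exact fun h => ha h.1
    have hHη : ∀ η : BondConfig V, H (openEdgeCluster η x) (setCl ω Y) = ∑ s : Option V, Λ s * (Ev s).indicator (1 : BondConfig V → ℝ) η := by
      intro η; simp only [hH]; exact Finset.sum_congr rfl fun s _ => by rw [hχη]
    have splitU : ∀ G : BondConfig V → ℝ, ∫ η, G η * H (openEdgeCluster η x) (setCl ω Y) ∂(prodBernoulli wX) =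
        ∑ s : Option V, Λ s * (∫ η in Ev s, G η ∂(prodBernoulli wX)) := by
      intro G
      have e1 : (fun η => G η * H (openEdgeCluster η x) (setCl ω Y)) = fun η =>
          ∑ s : Option V, Λ s * (G η * (Ev s).indicator (1 : BondConfig V → ℝ) η) := by
        funext η
        rw [hHη, Finset.mul_sum]
        exact Finset.sum_congr rfl fun s _ => by ring
      rw [e1, integral_finsetSum _ fun s _ => Integrable.of_finite]
      refine Finset.sum_congr rfl fun s _ => ?_
      rw [integral_const_mul]
      congr 1
      have : ∫ η, G η * (Ev s).indicator (1 : BondConfig V → ℝ) η ∂(prodBernoulli wX) =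
          ∫ η in Set.univ, G η * (Ev s).indicator (1 : BondConfig V → ℝ) η ∂(prodBernoulli wX) := by rw [Measure.restrict_univ]
      rw [this, KNPreFKG.setIntegral_mul_indicator_one, Set.univ_inter]
    have massU : ∫ η, H (openEdgeCluster η x) (setCl ω Y) ∂(prodBernoulli wX) = ∑ s : Option V, Λ s * (prodBernoulli wX).real (Ev s) := by
      have h2 := splitU (fun _ => (1 : ℝ))
      simp only [one_mul] at h2
      rw [h2]
      exact Finset.sum_congr rfl fun s _ => by rw [setIntegral_const, smul_eq_mul, mul_one]
    rw [integral_comp_sdiff_prodBernoulli' w wX _ h0 h1 (fun η => g (openEdgeCluster η x) * H (openEdgeCluster η x) (setCl ω Y)),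
      integral_comp_sdiff_prodBernoulli' w wX _ h0 h1 (fun η => g (openEdgeCluster η x)),
      integral_comp_sdiff_prodBernoulli' w wX _ h0 h1 (fun η => H (openEdgeCluster η x) (setCl ω Y)),
      splitU, massU, cshMarg_eq_sum_slots, Finset.mul_sum, ← Finset.sum_sub_distrib]
    refine Finset.sum_congr rfl fun s _ => ?_
    rw [hΛdef s]
    simp only [hEv]
    ring
  rw [setIntegral_congr_fun (hmeas _) fun ω _ => hfresh ω]
  exact hW g hg hg0

end CSHSet

end Summit.CriticalPhenomena.PercolationContinuityZ3.Theorems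

end
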